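import Summits.SmoothPoincare4.SmoothPoincare4.Theorems.ConvexBisectionAcyclicBisectionExistsOrseamPageDet
import Summits.SmoothPoincare4.SmoothPoincare4.Theorems.ConvexBisectionAcyclicBisectionExistsOrseamSeamFrames
import Summits.SmoothPoincare4.SmoothPoincare4.Theorems.ConvexBisectionAcyclicBisectionExistsSeamTwistSignGlobal
import HarnessLib

/-!
# Dual handles, node `Hgap` part C: the orientation character of the seam equals X3's twisting sign
(sub-goal of stub `stub_T3_dualPresentation` (T3) ▸ node `Hgap` ▸ part C (orientation character `Hχ`),
line `modp-braid-orbits`, crux `ConvexBisection.AcyclicBisectionExists`, item stmt-SmoothPoincare4-10508;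
wave 6, lead c5, worker G3; registered sub-goal `helper_twistSign_det4_flatten`)

The clause `Hχ(s)` of the node `Hgap` (second hypothesis of `T3_of_two_pieces`,
`…T3AssemblyClosed.lean`) asks, at ONE seam point, that the `det4`-orientation character of the seam
correspondence be `if s then +1 else -1`.  X4 reduced it to one frame computation
(`orientationCharacter_of_frame`) and proved THE COUPLING LEMMA `det4_sign_of_pageMap`
(orientation character of a fibred linear map = sign of its page determinant); X3 defined the
twisting sign `twistSign D bX Ψ y = sign pageDet (bdDeriv (S_1 ∘ seamB) y)` (`S` the universal
straightening at the canonical margin) and proved it constant on the flat part off the cores.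
This file closes the analytic half of the coupling:

* §1 `det4_ambDeriv_isotopy_pos_iff`: along a `rho`-preserving ambient isotopy `F_t` the sign of
  `det4 (∇rho (F_t p), dF_t W)` of a tangent frame `W` at a boundary point `p` is constant (continuous,
  never zero: `∇rho ≠ 0` is normal, `dF_t W` stays tangent and independent).
* §2 `twistSign_mul_det4_str_pos`: at a flat page point `y` off the cores, for every positive tangent
  frame `V` at `y`, `0 < twistSign y · det4 (∇rho (S_1 (seamB y)), Λ₁ V)`, `Λ₁ = bdDeriv (S_1 ∘ seamB) y`
  (`det4_sign_of_pageMap` applied to `Λ₁` made injective off the tangent hyperplane; its page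
  determinant IS `twistDet y`).
* §3 `twistSign_mul_det4_flatten_pos` (registered as `helper_twistSign_det4_flatten`): the same for
  `R_1 ∘ seamB` and ANY `rho`-preserving ambient isotopy `R` — no flatness of `seamB y` or of
  `R_1 (seamB y)` is needed (§1 along `S_t` and along `R_t`).  This is the side-2 sign of `Hχ` for the
  fibred transport of the dual data (`…HgapCharacter.lean`).

Everything is proved; no named facts, no `sorry`.

## References
* R. İ. Baykur, *Kähler decomposition of 4-manifolds*, AGT 6 (2006), §2.3 and proof of Thm. 5.1. [Baykur2006]
* J. B. Etnyre, T. Fuller, *Realizing 4-manifolds as achiral Lefschetz fibrations*, IMRN 2006, Thm. 1 (proof, p. 8). [EtnyreFuller2006]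
* J. M. Lee, *Introduction to Smooth Manifolds* (2013), Prop. 15.24. [LeeSmoothManifolds2013]
-/

noncomputable section

-- the prescribed namespace `Summit.<P>.<Sub>.…` duplicates `SmoothPoincare4` (P = Sub)
set_option linter.dupNamespace false

open scoped Manifold ContDiff Topology RealInnerProductSpace

namespace Summit.SmoothPoincare4.SmoothPoincare4.Theorems.AcyclicBisectionExists.ModpBraidOrbits

open Set Function Metric Module Filter
open Literature.Topology.FourManifolds Literature.Topology.FourManifolds.HandleAttachingMap
  Literature.Topology.FourManifolds.BoundaryManifold Literature.Topology.FourManifolds.LefschetzBase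
  Literature.Geometry.Symplectic

variable {g : ℕ}

/-! ## §1 The `det4`-sign of a tangent frame along a `rho`-preserving ambient isotopy -/

/-- `det4` of four continuously varying vectors is continuous. [folklore] -/
theorem continuous_det4_family {Y : Type*} [TopologicalSpace Y] {a b c d : Y → EuclideanSpace ℝ (Fin 4)}
    (ha : Continuous a) (hb : Continuous b) (hc : Continuous c) (hd : Continuous d) :
    Continuous fun y => det4 (a y) (b y) (c y) (d y) := by
  unfold det4
  refine Continuous.matrix_det (continuous_pi fun i => continuous_pi fun j => ?_)
  have hj : ∀ {e : Y → EuclideanSpace ℝ (Fin 4)}, Continuous e → Continuous fun y => e y j :=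
    fun he => (EuclideanSpace.proj j).continuous.comp he
  fin_cases i
  · simpa using hj ha
  · simpa using hj hb
  · simpa using hj hc
  · simpa using hj hd

/-- The gradient of `rho` is continuous. [folklore] -/
theorem continuous_gradient_rho : Continuous fun q : EuclideanSpace ℝ (Fin 4) => gradient (rho g) q := by
  have h1 : Continuous fun q : EuclideanSpace ℝ (Fin 4) => fderiv ℝ (rho g) q :=
    (contDiff_rho g).continuous_fderiv (by simp)
  exact (InnerProductSpace.toDual ℝ (EuclideanSpace ℝ (Fin 4))).symm.continuous.comp h1

/-- **Along a `rho`-preserving ambient isotopy a tangent frame keeps a non-zero `det4` against `∇rho`.**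
For `F_t` with `rho ∘ F_t = rho`, a boundary point `p` (`rho p = 1/4`) and a linearly independent frame
`W` tangent to `∂ Base g` at `p`: `det4 (∇rho (F_t p), dF_t W₀, dF_t W₁, dF_t W₂) ≠ 0` (`∇rho ≠ 0` is
normal, the `dF_t Wₖ` are tangent and independent). [cite: LeeSmoothManifolds2013, Prop. 15.24] -/
theorem det4_ambDeriv_isotopy_ne_zero (F : AmbientIsotopy (𝓡∂ 4) (Base g))
    (hρF : ∀ (t : ℝ) (x : Base g), rho g (F.toFun t x).1 = rho g x.1) (p : Base g)
    (hp : rho g p.1 = 1 / 4) (W : Fin 3 → EuclideanSpace ℝ (Fin 4))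
    (hW : ∀ k, fderiv ℝ (rho g) p.1 (W k) = 0) (hli : LinearIndependent ℝ W) (t : ℝ) :
    det4 (gradient (rho g) (F.toFun t p).1) (ambDeriv g (F.toFun t) p (W 0))
        (ambDeriv g (F.toFun t) p (W 1)) (ambDeriv g (F.toFun t) p (W 2)) ≠ 0 := by
  have hps : rho g (F.toFun t p).1 = 1 / 4 := by rw [hρF, hp]
  have hmd : MDifferentiableAt (𝓡∂ 4) (𝓡∂ 4) (F.toFun t) p :=
    (F.contMDiff_toFun t).mdifferentiableAt (by simp)
  have hker : LinearMap.ker ((ambDeriv g (F.toFun t) p : EuclideanSpace ℝ (Fin 4) →L[ℝ]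
      EuclideanSpace ℝ (Fin 4)) : EuclideanSpace ℝ (Fin 4) →ₗ[ℝ] EuclideanSpace ℝ (Fin 4)) = ⊥ :=
    LinearMap.ker_eq_bot.2 (injective_ambDeriv (F.isLocalDiffeomorph t) p)
  refine det4_ne_zero_of_normal_frame _ (fun k => ambDeriv g (F.toFun t) p (W k))
    (gradient_rho_ne_zero _ hps) (fun k => ?_) (hli.map' _ hker)
  rw [inner_gradient_eq_fderiv, fderiv_rho_ambDeriv hmd (hρF t), hW k]

/-- **The `det4`-orientation sign of a tangent frame is kept along a `rho`-preserving ambient isotopy.**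
For `F_t` with `rho ∘ F_t = rho`, a boundary point `p` (`rho p = 1/4`) and a linearly independent frame
`W` tangent to `∂ Base g` at `p`, `t ↦ det4 (∇rho (F_t p), dF_t W₀, dF_t W₁, dF_t W₂)` is continuous and
never vanishes, hence has the sign of its value `det4 (∇rho (p), W)` at `t = 0`.
[cite: LeeSmoothManifolds2013, Prop. 15.24] -/
theorem det4_ambDeriv_isotopy_pos_iff (F : AmbientIsotopy (𝓡∂ 4) (Base g))
    (hρF : ∀ (t : ℝ) (x : Base g), rho g (F.toFun t x).1 = rho g x.1) (p : Base g)
    (hp : rho g p.1 = 1 / 4) (W : Fin 3 → EuclideanSpace ℝ (Fin 4))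
    (hW : ∀ k, fderiv ℝ (rho g) p.1 (W k) = 0) (hli : LinearIndependent ℝ W) (t : ℝ) :
    0 < det4 (gradient (rho g) (F.toFun t p).1) (ambDeriv g (F.toFun t) p (W 0))
        (ambDeriv g (F.toFun t) p (W 1)) (ambDeriv g (F.toFun t) p (W 2)) ↔
      0 < det4 (gradient (rho g) p.1) (W 0) (W 1) (W 2) := by
  -- the sign function along the isotopy
  obtain ⟨f, hf⟩ : ∃ f : ℝ → ℝ, ∀ s, f s = det4 (gradient (rho g) (F.toFun s p).1)
      (ambDeriv g (F.toFun s) p (W 0)) (ambDeriv g (F.toFun s) p (W 1)) (ambDeriv g (F.toFun s) p (W 2)) :=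
    ⟨_, fun s => rfl⟩
  have hpath : Continuous fun s : ℝ => ((F.toFun s p).1 : EuclideanSpace ℝ (Fin 4)) :=
    continuous_subtype_val.comp (F.contMDiff.continuous.comp (continuous_id.prodMk continuous_const))
  have hamb : ∀ k, Continuous fun s : ℝ => ambDeriv g (F.toFun s) p (W k) := fun k =>
    (continuous_ambDeriv_isotopy F p).clm_apply continuous_const
  have hfc : Continuous f := by
    have := continuous_det4_family ((continuous_gradient_rho (g := g)).comp hpath) (hamb 0) (hamb 1) (hamb 2)
    exact this.congr fun s => (hf s).symm
  -- never zero
  have hf0 : ∀ s, f s ≠ 0 := fun s => by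
    rw [hf s]; exact det4_ambDeriv_isotopy_ne_zero F hρF p hp W hW hli s
  -- hence of constant sign
  have key : ∀ s, (0 < f s ↔ 0 < f 0) := by
    intro s
    by_contra hne
    have hsub := intermediate_value_uIcc (a := s) (b := 0) hfc.continuousOn
    have h0mem : (0 : ℝ) ∈ uIcc (f s) (f 0) := by
      rcases lt_or_gt_of_ne (hf0 s) with hs | hs <;> rcases lt_or_gt_of_ne (hf0 0) with h0' | h0'
      · exact absurd (iff_of_false (not_lt.2 hs.le) (not_lt.2 h0'.le)) hne
      · exact mem_uIcc.2 (Or.inl ⟨hs.le, h0'.le⟩)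
      · exact mem_uIcc.2 (Or.inr ⟨h0'.le, hs.le⟩)
      · exact absurd (iff_of_true hs h0') hne
    obtain ⟨r, -, hr⟩ := hsub h0mem
    exact hf0 r hr
  -- the value at `t = 0`
  have h0 : f 0 = det4 (gradient (rho g) p.1) (W 0) (W 1) (W 2) := by
    rw [hf 0, F.map_zero, ambDeriv_id]
    rfl
  rw [← hf t, key t, h0]

/-- Three of four vectors with non-zero `det4` are linearly independent. [folklore] -/
theorem linearIndependent_of_det4_ne_zero {n a b c : EuclideanSpace ℝ (Fin 4)} (h : det4 n a b c ≠ 0) :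
    LinearIndependent ℝ ![a, b, c] := by
  have hu : IsUnit ((PiLp.basisFun 2 ℝ (Fin 4)).det ![n, a, b, c]) := by
    rw [← det4_eq_basis_det]; exact isUnit_iff_ne_zero.2 h
  have hli4 := ((PiLp.basisFun 2 ℝ (Fin 4)).is_basis_iff_det.2 hu).1
  have e : (![a, b, c] : Fin 3 → EuclideanSpace ℝ (Fin 4)) = ![n, a, b, c] ∘ Fin.succ := by
    funext k
    fin_cases k <;> rfl
  rw [e]
  exact hli4.comp Fin.succ (Fin.succ_injective _)

/-! ## §2 The side-2 sign at the flat end of the universal straightening -/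

section Str

variable {ι : Type} [Finite ι] {h : ι → HandleAttachingMap 3 2 (Base g)}
  {X : Type} [TopologicalSpace X] [ChartedSpace (EuclideanHalfSpace 4) X] [IsManifold (𝓡∂ 4) ∞ X]
  (D : MultiAttachmentData h (𝓡∂ 4) X) (bX : BoundaryData (𝓡∂ 4) X (𝓡 3)) [Nonempty bX.carrier]
  (Ψ : bX.carrier ≃ₘ⟮𝓡 3, 𝓡 3⟯ (bBase g).carrier)
  (hpage : ∀ (y : bX.carrier) (a : ↥(coresComplement h)), bX.incl y = D.jA a →
    ∃ c : ℝ, 0 < c ∧ w g ((bBase g).incl (Ψ y)).1 = (c : ℂ) * w g (a : Base g).1)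

/-- **Extension of a boundary ambient differential to an injective map of `ℝ⁴`.**  If `Λ` maps every
vector into the tangent hyperplane at `q'` and kills no non-zero tangent vector at `q`, then
`Λ' X = Λ X + ⟪∇rho (q), X⟫ ∇rho (q')` is injective and agrees with `Λ` on the tangent hyperplane at `q`.
[folklore] -/
theorem exists_injective_extension {q q' : EuclideanSpace ℝ (Fin 4)} (hq' : gradient (rho g) q' ≠ 0)
    (Λ : EuclideanSpace ℝ (Fin 4) →L[ℝ] EuclideanSpace ℝ (Fin 4))
    (hΛt : ∀ X, fderiv ℝ (rho g) q' (Λ X) = 0)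
    (hΛi : ∀ X, fderiv ℝ (rho g) q X = 0 → Λ X = 0 → X = 0) :
    ∃ Λ' : EuclideanSpace ℝ (Fin 4) →L[ℝ] EuclideanSpace ℝ (Fin 4), Injective Λ' ∧
      ∀ X, fderiv ℝ (rho g) q X = 0 → Λ' X = Λ X := by
  refine ⟨Λ + (ContinuousLinearMap.toSpanSingleton ℝ (gradient (rho g) q')).comp
    (innerSL ℝ (gradient (rho g) q)), fun X Y hXY => ?_, fun X hX => ?_⟩
  · -- injectivity
    have e : ∀ Z, (Λ + (ContinuousLinearMap.toSpanSingleton ℝ (gradient (rho g) q')).comp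
        (innerSL ℝ (gradient (rho g) q))) Z = Λ Z + ⟪gradient (rho g) q, Z⟫ • gradient (rho g) q' :=
      fun Z => rfl
    rw [e, e] at hXY
    have hsub : Λ (X - Y) + ⟪gradient (rho g) q, X - Y⟫ • gradient (rho g) q' = 0 := by
      rw [map_sub, inner_sub_right, sub_smul]
      have := sub_eq_zero.2 hXY
      rw [← this]; abel
    -- pair with `∇rho (q')`: the tangent part is orthogonal
    have h1 : ⟪gradient (rho g) q', Λ (X - Y)⟫ = 0 := by rw [inner_gradient_eq_fderiv, hΛt]
    have h2 := congrArg (fun v => ⟪gradient (rho g) q', v⟫) hsub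
    simp only [inner_add_right, h1, zero_add, real_inner_smul_right, inner_zero_right,
      real_inner_self_eq_norm_sq, mul_eq_zero] at h2
    have hXY0 : ⟪gradient (rho g) q, X - Y⟫ = 0 := by
      rcases h2 with h2 | h2
      · exact h2
      · exact absurd (pow_eq_zero_iff two_ne_zero |>.1 h2) (norm_ne_zero_iff.2 hq')
    rw [hXY0, zero_smul, add_zero] at hsub
    have htan : fderiv ℝ (rho g) q (X - Y) = 0 := by rw [← inner_gradient_eq_fderiv, hXY0]
    exact sub_eq_zero.1 (hΛi _ htan hsub)
  · show Λ X + ⟪gradient (rho g) q, X⟫ • gradient (rho g) q' = Λ X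
    rw [inner_gradient_eq_fderiv, hX, zero_smul, add_zero]

include hpage in
/-- **The side-2 sign at the flat end of the universal straightening.**  At a flat page point `y` of
`∂ Base g` off the cores, with `S = strIso g (seamMargin y)` and `Λ₁ = bdDeriv (S_1 ∘ seamB) y`, every
tangent frame `V` at `y` with `det4 (∇rho (y), V) > 0` has `0 < twistSign y · det4 (∇rho (S_1 (seamB y)), Λ₁ V)`:
X4's coupling `det4_sign_of_pageMap` for `Λ₁` (whose page determinant is X3's `twistDet y`).
[cite: Baykur2006, §2.3] -/
theorem twistSign_mul_det4_str_pos {y : (bBase g).carrier} (hy : (y.1 : Base g) ∈ coresComplement h)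
    (hflat : ‖cx y.1.1‖ ^ 2 < 4) (hm : 0 < seamMargin D bX Ψ y) (V : Fin 3 → EuclideanSpace ℝ (Fin 4))
    (hV : ∀ k, fderiv ℝ (rho g) y.1.1 (V k) = 0)
    (hpos : 0 < det4 (gradient (rho g) y.1.1) (V 0) (V 1) (V 2)) :
    0 < (twistSign D bX Ψ y : ℝ) *
      det4 (gradient (rho g) (((strIso g (seamMargin D bX Ψ y) hm).toFun 1 ∘ seamB D bX Ψ) y).1)
        (bdDeriv g ((strIso g (seamMargin D bX Ψ y) hm).toFun 1 ∘ seamB D bX Ψ) y (V 0))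
        (bdDeriv g ((strIso g (seamMargin D bX Ψ y) hm).toFun 1 ∘ seamB D bX Ψ) y (V 1))
        (bdDeriv g ((strIso g (seamMargin D bX Ψ y) hm).toFun 1 ∘ seamB D bX Ψ) y (V 2)) := by
  set S := strIso g (seamMargin D bX Ψ y) hm with hS
  set G := S.toFun 1 ∘ seamB D bX Ψ with hG
  set Λ := bdDeriv g G y with hΛ
  obtain ⟨c, hc, hyc⟩ := exists_mem_page_of_flat hflat ((RegularSublevel.mem_boundary_iff _ _).1 y.2)
  obtain ⟨-, hw⟩ := flat_of_mem_page hc hyc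
  obtain ⟨-, hmw⟩ := seamMargin_pos D bX Ψ hpage hy hc hyc
  have hGy : G y ∈ page g c := str_seamB_mem_page D bX Ψ hpage hm hy hc hyc hmw
  obtain ⟨hflat', hw'⟩ := flat_of_mem_page hc hGy
  -- the fibred structure of `Λ`
  have hsB : MDifferentiableAt (𝓡 3) (𝓡∂ 4) (seamB D bX Ψ) y :=
    (contMDiffAt_seamB D bX Ψ hy).mdifferentiableAt (by simp)
  have hGd : MDifferentiableAt (𝓡 3) (𝓡∂ 4) G y :=
    ((S.contMDiff_toFun 1).mdifferentiableAt (by simp)).comp y hsB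
  have hbd : ∀ y', rho g (G y').1 = 1 / 4 := fun y' => by
    rw [hG, Function.comp_apply, str_rho_base, rho_seamB]
  obtain ⟨hρΛ, ⟨κ, hκ, hnΛ⟩, hLΛ⟩ := helper_bdDeriv_fibred g G y hGd hbd
    (eventually_w_comp_seamB D bX Ψ (str_dir_base _ hm 1) hpage hy) hflat hflat' hw
  have hinj : Injective (mfderiv (𝓡 3) (𝓡∂ 4) G y) := by
    rw [hG, mfderiv_comp y ((S.contMDiff_toFun 1).mdifferentiableAt (by simp)) hsB]
    exact ((S.isLocalDiffeomorph 1 _).mfderivToContinuousLinearEquiv (by simp)).injective.comp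
      (injective_mfderiv_seamB D bX Ψ hy)
  -- the injective extension `Λ'`
  obtain ⟨Λ', hΛ'i, hΛ'⟩ := exists_injective_extension (gradient_rho_ne_zero (G y) (hbd y)) Λ hρΛ
    (fun X hX hX0 => bdDeriv_eq_zero_imp hGd hinj hX hX0)
  -- page tangents are tangent
  have tanL : ∀ X, dPhiX g y.1.1 * cx X + dPhiY y.1.1 * cy X = 0 → fderiv ℝ (rho g) y.1.1 X = 0 :=
    fun X hX => fderiv_rho_pageTangent hflat hX
  have hT := dPhi_pageVec (g := g) y.1.1
  have hiT := dPhi_cplxJ_pageVec (g := g) y.1.1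
  -- the coupling lemma for `Λ'`
  have key := det4_sign_of_pageMap (coe_ne_zero y.1) (coe_ne_zero (G y)) hflat hflat' hw hw' Λ' hΛ'i
    (fun X hX => by rw [hΛ' X hX]; exact hρΛ X) κ hκ
    (fun X hX => by rw [hΛ' X hX]; exact hnΛ X hX)
    (fun X hX => by rw [hΛ' X (tanL X hX)]; exact hLΛ X hX)
    (pageVec g y.1.1) (pageVec_ne_zero (coe_ne_zero y.1)) hT V hV hpos
  rw [hΛ' _ (tanL _ hiT), hΛ' _ (tanL _ hT), hΛ' _ (hV 0), hΛ' _ (hV 1), hΛ' _ (hV 2)] at key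
  -- the first factor is `twistDet y`
  have htw : inner ℝ (Λ (cplxJ (pageVec g y.1.1))) (cplxJ (Λ (pageVec g y.1.1))) = twistDet D bX Ψ y := by
    unfold twistDet
    rw [dif_pos hm]
    rfl
  rw [htw] at key
  have hne : twistDet D bX Ψ y ≠ 0 := twistDet_ne_zero D bX Ψ hpage hy hc hyc
  unfold twistSign
  by_cases h0 : 0 < twistDet D bX Ψ y
  · rw [if_pos h0]; push_cast; rw [one_mul]
    exact (mul_pos_iff_of_pos_left h0).1 key
  · rw [if_neg h0]; push_cast
    have hneg : twistDet D bX Ψ y < 0 := lt_of_le_of_ne (not_lt.1 h0) hne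
    have : det4 (gradient (rho g) (G y).1) (Λ (V 0)) (Λ (V 1)) (Λ (V 2)) < 0 := by
      by_contra hc'
      push Not at hc'
      have := mul_nonpos_of_nonpos_of_nonneg hneg.le hc'
      linarith
    linarith

include hpage in
/-- **The side-2 sign of `Hχ` for a fibred flattening of the seam map.**  At a flat page point `y` of
`∂ Base g` off the cores and for ANY `rho`-preserving ambient isotopy `R` of `Base g`, every tangent frame
`V` at `y` with `det4 (∇rho (y), V) > 0` has
`0 < twistSign y · det4 (∇rho (R_1 (seamB y)), Λ V)`, `Λ = bdDeriv (R_1 ∘ seamB) y = dR_1 ∘ bdDeriv seamB y`: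
§2 at the flat end of the universal straightening `S`, then the sign is carried back along `S_t` and
forth along `R_t` (`det4_ambDeriv_isotopy_pos_iff`; the frame `bdDeriv seamB y V` is independent because
its `S_1`-image has non-zero `det4`).  No flatness of `seamB y` or `R_1 (seamB y)` is needed.
[cite: Baykur2006, §2.3] -/
theorem twistSign_mul_det4_flatten_pos (R : AmbientIsotopy (𝓡∂ 4) (Base g))
    (hρR : ∀ (t : ℝ) (x : Base g), rho g (R.toFun t x).1 = rho g x.1)
    {y : (bBase g).carrier} (hy : (y.1 : Base g) ∈ coresComplement h)
    (hflat : ‖cx y.1.1‖ ^ 2 < 4) (V : Fin 3 → EuclideanSpace ℝ (Fin 4))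
    (hV : ∀ k, fderiv ℝ (rho g) y.1.1 (V k) = 0)
    (hpos : 0 < det4 (gradient (rho g) y.1.1) (V 0) (V 1) (V 2)) :
    0 < (twistSign D bX Ψ y : ℝ) *
      det4 (gradient (rho g) ((R.toFun 1 ∘ seamB D bX Ψ) y).1)
        (bdDeriv g (R.toFun 1 ∘ seamB D bX Ψ) y (V 0))
        (bdDeriv g (R.toFun 1 ∘ seamB D bX Ψ) y (V 1))
        (bdDeriv g (R.toFun 1 ∘ seamB D bX Ψ) y (V 2)) := by
  obtain ⟨c, hc, hyc⟩ := exists_mem_page_of_flat hflat ((RegularSublevel.mem_boundary_iff _ _).1 y.2)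
  obtain ⟨hm, -⟩ := seamMargin_pos D bX Ψ hpage hy hc hyc
  have hsB : MDifferentiableAt (𝓡 3) (𝓡∂ 4) (seamB D bX Ψ) y :=
    (contMDiffAt_seamB D bX Ψ hy).mdifferentiableAt (by simp)
  have hS1 : MDifferentiableAt (𝓡∂ 4) (𝓡∂ 4) ((strIso g (seamMargin D bX Ψ y) hm).toFun 1)
      (seamB D bX Ψ y) := ((strIso g (seamMargin D bX Ψ y) hm).contMDiff_toFun 1).mdifferentiableAt (by simp)
  have hR1 : MDifferentiableAt (𝓡∂ 4) (𝓡∂ 4) (R.toFun 1) (seamB D bX Ψ y) :=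
    (R.contMDiff_toFun 1).mdifferentiableAt (by simp)
  have hpρ : rho g (seamB D bX Ψ y).1 = 1 / 4 := rho_seamB D bX Ψ y
  -- the frame `W := bdDeriv seamB y V` is tangent at `seamB y`
  have hW : ∀ k, fderiv ℝ (rho g) (seamB D bX Ψ y).1 (bdDeriv g (seamB D bX Ψ) y (V k)) = 0 := fun k =>
    fderiv_rho_bdDeriv hsB (rho_seamB D bX Ψ) (V k)
  -- §2 at the flat end of `S`
  have key := twistSign_mul_det4_str_pos D bX Ψ hpage hy hflat hm V hV hpos
  rw [bdDeriv_comp hS1 hsB] at key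
  simp only [ContinuousLinearMap.comp_apply, Function.comp_apply] at key
  -- `W` is linearly independent: its `dS_1`-image has non-zero `det4`
  have hli : LinearIndependent ℝ (fun k => bdDeriv g (seamB D bX Ψ) y (V k)) := by
    have hne : det4 (gradient (rho g) ((strIso g (seamMargin D bX Ψ y) hm).toFun 1 (seamB D bX Ψ y)).1)
        (ambDeriv g ((strIso g (seamMargin D bX Ψ y) hm).toFun 1) (seamB D bX Ψ y)
          (bdDeriv g (seamB D bX Ψ) y (V 0)))
        (ambDeriv g ((strIso g (seamMargin D bX Ψ y) hm).toFun 1) (seamB D bX Ψ y)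
          (bdDeriv g (seamB D bX Ψ) y (V 1)))
        (ambDeriv g ((strIso g (seamMargin D bX Ψ y) hm).toFun 1) (seamB D bX Ψ y)
          (bdDeriv g (seamB D bX Ψ) y (V 2))) ≠ 0 := by
      intro h0; rw [h0, mul_zero] at key; exact lt_irrefl _ key
    have h3 := linearIndependent_of_det4_ne_zero hne
    have h3' : LinearIndependent ℝ (((ambDeriv g ((strIso g (seamMargin D bX Ψ y) hm).toFun 1)
        (seamB D bX Ψ y) : EuclideanSpace ℝ (Fin 4) →L[ℝ] EuclideanSpace ℝ (Fin 4)) :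
          EuclideanSpace ℝ (Fin 4) →ₗ[ℝ] EuclideanSpace ℝ (Fin 4)) ∘
        fun k => bdDeriv g (seamB D bX Ψ) y (V k)) := by
      convert h3 using 1
      funext k
      fin_cases k <;> rfl
    exact LinearIndependent.of_comp _ h3'
  -- carry the sign back along `S_t` and forth along `R_t`
  have eS := det4_ambDeriv_isotopy_pos_iff (strIso g (seamMargin D bX Ψ y) hm) (str_rho_base _ hm)
    (seamB D bX Ψ y) hpρ (fun k => bdDeriv g (seamB D bX Ψ) y (V k)) hW hli 1
  have eR := det4_ambDeriv_isotopy_pos_iff R hρR (seamB D bX Ψ y) hpρ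
    (fun k => bdDeriv g (seamB D bX Ψ) y (V k)) hW hli 1
  have nR := det4_ambDeriv_isotopy_ne_zero R hρR (seamB D bX Ψ y) hpρ
    (fun k => bdDeriv g (seamB D bX Ψ) y (V k)) hW hli 1
  rw [bdDeriv_comp hR1 hsB]
  simp only [ContinuousLinearMap.comp_apply, Function.comp_apply] at eS eR nR ⊢
  rcases twistSign_eq_one_or D bX Ψ y with h1 | h1 <;> rw [h1] at key ⊢ <;> push_cast at key ⊢
  · rw [one_mul] at key ⊢
    exact eR.2 (eS.1 key)
  · rw [neg_one_mul, neg_pos] at key ⊢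
    have h2 : ¬ 0 < det4 (gradient (rho g) (seamB D bX Ψ y).1) (bdDeriv g (seamB D bX Ψ) y (V 0))
        (bdDeriv g (seamB D bX Ψ) y (V 1)) (bdDeriv g (seamB D bX Ψ) y (V 2)) :=
      fun h' => absurd (eS.2 h') (not_lt.2 key.le)
    exact lt_of_le_of_ne (not_lt.1 fun h' => h2 (eR.1 h')) nR

end Str

/-! ## §4 The registered package -/

/-- **Sub-goal `helper_twistSign_det4_flatten` of stub `stub_T3_dualPresentation`** (T3 ▸ node `Hgap` ▸
part C, the orientation character; wave 6, lead c5, worker G3): **the `det4`-orientation character of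
every fibred flattening `R_1 ∘ seamB` of the seam map at a flat page point `y` off the cores is X3's
twisting sign `twistSign y`** — for every `rho`-preserving ambient isotopy `R` and every tangent frame
`V` at `y` positive against `∇rho`, `0 < twistSign y · det4 (∇rho (R_1 (seamB y)), bdDeriv (R_1 ∘ seamB) y V)`.
[cite: Baykur2006, §2.3] -/
theorem helper_twistSign_det4_flatten : ∀ (g : ℕ) (ι : Type) [Finite ι] (h : ι → Literature.Topology.FourManifolds.HandleAttachingMap 3 2 (Literature.Topology.FourManifolds.LefschetzBase.Base g)) (X : Type) [TopologicalSpace X] [ChartedSpace (EuclideanHalfSpace 4) X] [IsManifold (𝓡∂ 4) ∞ X] (D : Literature.Topology.FourManifolds.HandleAttachingMap.MultiAttachmentData h (𝓡∂ 4) X) (bX : Literature.Topology.FourManifolds.BoundaryData (𝓡∂ 4) X (𝓡 3)) [Nonempty bX.carrier] (Ψ : bX.carrier ≃ₘ⟮𝓡 3, 𝓡 3⟯ (Literature.Topology.FourManifolds.LefschetzBase.bBase g).carrier), (∀ (y : bX.carrier) (a : ↥(Literature.Topology.FourManifolds.HandleAttachingMap.coresComplement h)), bX.incl y = D.jA a →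 ∃ c : ℝ, 0 < c ∧ Literature.Topology.FourManifolds.LefschetzBase.w g ((Literature.Topology.FourManifolds.LefschetzBase.bBase g).incl (Ψ y)).1 = (c : ℂ) * Literature.Topology.FourManifolds.LefschetzBase.w g (a : Literature.Topology.FourManifolds.LefschetzBase.Base g).1) → ∀ (R : Literature.Topology.FourManifolds.AmbientIsotopy (𝓡∂ 4) (Literature.Topology.FourManifolds.LefschetzBase.Base g)), (∀ (t : ℝ) (x : Literature.Topology.FourManifolds.LefschetzBase.Base g), Literature.Topology.FourManifolds.LefschetzBase.rho g (R.toFun t x).1 = Literature.Topology.FourManifolds.LefschetzBase.rho g x.1) → ∀ (y : (Literature.Topology.FourManifolds.LefschetzBase.bBase g).carrier), (y.1 : Literature.Topology.FourManifolds.LefschetzBase.Base g) ∈ Literature.Topology.FourManifolds.HandleAttachingMap.coresComplement h → ‖Literature.Topology.FourManifolds.LefschetzBase.cx y.1.1‖ ^ 2 < 4 → ∀ (V : Fin 3 → EuclideanSpace ℝ (Fin 4)), (∀ k, fderiv ℝ (Literature.Topology.FourManifolds.LefschetzBase.rho g) y.1.1 (V k) = 0) → 0 < Literature.Geometry.Symplectic.det4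 (gradient (Literature.Topology.FourManifolds.LefschetzBase.rho g) y.1.1) (V 0) (V 1) (V 2) → 0 < (Summit.SmoothPoincare4.SmoothPoincare4.Theorems.AcyclicBisectionExists.ModpBraidOrbits.twistSign D bX Ψ y : ℝ) * Literature.Geometry.Symplectic.det4 (gradient (Literature.Topology.FourManifolds.LefschetzBase.rho g) ((R.toFun 1 ∘ Summit.SmoothPoincare4.SmoothPoincare4.Theorems.AcyclicBisectionExists.ModpBraidOrbits.seamB D bX Ψ) y).1) (Summit.SmoothPoincare4.SmoothPoincare4.Theorems.AcyclicBisectionExists.ModpBraidOrbits.bdDeriv g (R.toFun 1 ∘ Summit.SmoothPoincare4.SmoothPoincare4.Theorems.AcyclicBisectionExists.ModpBraidOrbits.seamB D bX Ψ) y (V 0)) (Summit.SmoothPoincare4.SmoothPoincare4.Theorems.AcyclicBisectionExists.ModpBraidOrbits.bdDeriv g (R.toFun 1 ∘ Summit.SmoothPoincare4.SmoothPoincare4.Theorems.AcyclicBisectionExists.ModpBraidOrbits.seamB D bX Ψ) y (V 1)) (Summit.SmoothPoincare4.SmoothPoincare4.Theorems.AcyclicBisectionExists.ModpBraidOrbits.bdDeriv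 g (R.toFun 1 ∘ Summit.SmoothPoincare4.SmoothPoincare4.Theorems.AcyclicBisectionExists.ModpBraidOrbits.seamB D bX Ψ) y (V 2)) :=
  fun _ _ _ _ _ _ _ _ D bX _ Ψ hpage R hρR _ hy hflat V hV hpos =>
    twistSign_mul_det4_flatten_pos D bX Ψ hpage R hρR hy hflat V hV hpos

end Summit.SmoothPoincare4.SmoothPoincare4.Theorems.AcyclicBisectionExists.ModpBraidOrbits

end
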